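import Mathlib
import Summits.NavierStokesRegularity.NavierStokesRegularity.Theses.SymmetryModuliCount
import Literature.Analysis.FluidPDE.TypeIAncientMild
import Literature.Analysis.FluidPDE.OseenSlice
import Literature.Analysis.FluidPDE.OseenMildUniqueness
import HarnessLib

/-!
# Route SymmetryModuliCount — crux `HelicalEndLiouville` (stmt-NavierStokesRegularity-14062),
# line `vanishing-cell-reynolds`, stub 7: vanishing on a backward end propagates forward

`stub_forwardVanishing` (= route support item `BackwardEndVanishing`,
stmt-NavierStokesRegularity-14064, verbatim): a Type-I ancient mild field `u`
(`IsTypeIAncientMild C u`, Oseen/KNSS gauge) which vanishes for all `t < θ` (`θ ≤ 0`) vanishes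
for all `t < 0`.

Proof (forward uniqueness of bounded solutions of the Oseen integral equation, KNSS 2009 §4,
(4.3)–(4.4): "`u = U + B(u,u)` … as an ODE in `t`"). Fix `t₀` with `θ ≤ t₀ < 0` (for `t₀ < θ`
the hypothesis applies). On the window `(s, T) = (θ - 1, t₀/2)` the field `u` is bounded by
`C/√(-T)` (`IsTypeIAncientMild.norm_le_of_mem_Ioo`), jointly measurable
(`IsTypeIAncientMild.aestronglyMeasurable_uncurry`) and solves
`u(t) = e^{(t-s)Δ}u(s) - B¹_s(u,u)(t)` (`IsTypeIAncientMild.mild_eq_heatExtension`). Since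
`u(s) = 0`, the free term `e^{(t-s)Δ}u(s)` vanishes (`heatExtension_zero_fun`), so the zero field
solves the same equation (`oseenDuhamel_zero_left`); by uniqueness of bounded solutions
(`oseenMild_bounded_unique`) `u(t₀) = 0` a.e., hence everywhere by continuity of the slice
(`IsTypeIAncientMild.continuous_slice`, `Continuous.ae_eq_iff_eq`).

References: G. Koch, N. Nadirashvili, G. Seregin, V. Šverák, *Liouville theorems for the
Navier–Stokes equations and applications*, Acta Math. 203 (2009) = arXiv:0709.3599, §4 p. 8.
-/

noncomputable section

-- the summit and its single sub-problem share the name (CONVENTIONS §1), as in every Theorems file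
set_option linter.dupNamespace false

open Set MeasureTheory Function Filter
open Literature.Analysis.FluidPDE
open Literature.Analysis.UnboundedOperators (heatExtension)
open scoped RealInnerProductSpace Topology

namespace Summit.NavierStokesRegularity.NavierStokesRegularity.Theorems

local notation "E3" => EuclideanSpace ℝ (Fin 3)

/-- **Stub 7 (vanishing on a backward end propagates forward).** A Type-I ancient mild field in
the Oseen gauge which vanishes for `t < θ` (`θ ≤ 0`) vanishes for all `t < 0`: on the window
`(θ - 1, t₀/2)` both `u` and `0` are bounded, jointly measurable solutions of the Oseen integral
equation with the same (vanishing) free term `e^{(t-s)Δ}u(s) = 0`, so they agree a.e.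
(`oseenMild_bounded_unique`, KNSS 2009 §4 (4.3)–(4.4)), hence everywhere by continuity of the
slices. [cite: KochNadirashviliSereginSverak2009, §4 (4.3)–(4.4) (arXiv:0709.3599 p. 8)] -/
theorem stub_forwardVanishing :
    ∀ (C : ℝ) (u : ℝ → E3 → E3), IsTypeIAncientMild C u → ∀ θ : ℝ, θ ≤ 0 →
      (∀ t < θ, ∀ x, u t x = 0) → ∀ t < 0, ∀ x, u t x = 0 := by
  intro C u hu θ _hθ hzero t₀ ht₀ x₀
  rcases lt_or_ge t₀ θ with hlt | hge
  · exact hzero t₀ hlt x₀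
  -- window `(s, T) = (θ - 1, t₀ / 2)`, bound `M = C/√(-T)`
  have hT0 : t₀ / 2 < 0 := by linarith
  have ht₀mem : t₀ ∈ Ioo (θ - 1) (t₀ / 2) := ⟨by linarith, by linarith⟩
  have hus : u (θ - 1) = fun _ => (0 : E3) := funext fun x => hzero _ (by linarith) x
  have hM : 0 ≤ C / Real.sqrt (-(t₀ / 2)) := div_nonneg hu.nonneg (Real.sqrt_nonneg _)
  have huM : ∀ τ ∈ Ioo (θ - 1) (t₀ / 2), ∀ y, ‖u τ y‖ ≤ C / Real.sqrt (-(t₀ / 2)) :=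
    fun τ hτ y => hu.norm_le_of_mem_Ioo hT0 hτ y
  have hvM : ∀ τ ∈ Ioo (θ - 1) (t₀ / 2), ∀ y : E3,
      ‖(0 : ℝ → E3 → E3) τ y‖ ≤ C / Real.sqrt (-(t₀ / 2)) :=
    fun _ _ _ => norm_zero.trans_le hM
  have hvm : AEStronglyMeasurable (uncurry (0 : ℝ → E3 → E3))
      ((volume : Measure (ℝ × E3)).restrict (Ioo (θ - 1) (t₀ / 2) ×ˢ univ)) :=
    show AEStronglyMeasurable (fun _ : ℝ × E3 => (0 : E3)) _ from aestronglyMeasurable_const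
  -- uniqueness of bounded solutions of the Oseen equation with free term `e^{(t-s)Δ}u(s)`
  have key := oseenMild_bounded_unique (ν := 1) (s := θ - 1) (T := t₀ / 2)
    (M := C / Real.sqrt (-(t₀ / 2))) (u := u) (v := 0)
    (U := fun t x => heatExtension (u (θ - 1)) (t - (θ - 1)) x) one_pos hM
    (hu.aestronglyMeasurable_uncurry hT0.le) hvm huM hvM
    (fun t ht => Eventually.of_forall fun x => hu.mild_eq_heatExtension ht.1 (ht.2.trans hT0) x)
    (fun t _ => Eventually.of_forall fun x => by
      simp only [Pi.zero_apply, oseenDuhamel_zero_left, hus,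
        Literature.Analysis.UnboundedOperators.heatExtension_zero_fun, sub_zero])
  -- a.e. ⇒ everywhere, by continuity of the slice
  have heq : u t₀ = (0 : ℝ → E3 → E3) t₀ :=
    (Continuous.ae_eq_iff_eq volume (hu.continuous_slice ht₀) continuous_const).1
      (key t₀ ht₀mem)
  exact congrFun heq x₀

/-- Route support item `BackwardEndVanishing` (stmt-NavierStokesRegularity-14064), by
`stub_forwardVanishing`. [folklore] -/
theorem symmetryModuliCount_backwardEndVanishing_proof :
    Summit.NavierStokesRegularity.NavierStokesRegularity.Theses.SymmetryModuliCount.BackwardEndVanishing :=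
  stub_forwardVanishing

end Summit.NavierStokesRegularity.NavierStokesRegularity.Theorems

end
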